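import Literature.Geometry.Riemannian.SphericalCylinderEntropy
import Literature.Geometry.Riemannian.SphericalZonalKernelSeries
import Literature.Geometry.Riemannian.SphericalZonalFourDuality
import Summits.SmoothPoincare4.SmoothPoincare4.Theorems.CylinderEntropyThinCrossSectionExistsStubSliceDensity
import Mathlib.MeasureTheory.Integral.DominatedConvergence
import HarnessLib

/-!
# Stub K2 `stub_zonalSphereIntegral` of line `ball-mass-slack` (crux `ThinCrossSectionExists`, stmt-SmoothPoincare4-7633)

**Only the `k = 0` mode survives.**  Given the Funk–Hecke vanishing `∫_{S⁴} C_k^{(3/2)}(∑ xᵢuᵢ) dμHE⁴ = 0` for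
`k ≥ 1` (stub K1 `stub_funkHeckeVanishing`, taken here as the hypothesis, verbatim), the typed zonal heat series
`𝔥(τ, s) = ∑_k wt k τ · C_k^{(3/2)}(s)` of the round `S⁴` has total mass

  `∫_{S⁴} 𝔥(τ, ∑ xᵢuᵢ) dμHE⁴(x) = μHE⁴(S⁴)`   (`τ > 0`, `u` a unit vector),

as a real number: on the sphere `|∑ xᵢuᵢ| ≤ 1`, so the tree bound
`Literature.Geometry.Riemannian.SphericalZonalKernelSeries.norm_wt_mul_gegen_le` (with `R = 1`) dominates the `k`-th term
uniformly by the summable majorant `e^{-k²τ}((k+3)!)² 2^k` (`summable_majorant`); hence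
`MeasureTheory.integral_tsum_of_summable_integral_norm` exchanges `∫` and `∑'` on the finite measure `μHE⁴⌊S⁴`, the
`k ≥ 1` integrals vanish by K1, and the `k = 0` term `wt 0 τ · C_0 = 1` integrates to `μHE⁴(S⁴)`.

This is the registered signature `stub_zonalSphereIntegral` of the lead-1 skeleton
`Cruxes/ThinCrossSectionExists/Lines/ball_mass_slack.lean` (sha `fa8f6255…`).  Pure proofs over tree vocabulary (`zonal`,
`wt`, `gegen`) and Mathlib's `μHE` (sphere facts reused from the landed K3 file `…StubSliceDensity`); no definitions, no facts.  Seat: prover-line-stmt-SmoothPoincare4-7633-c1-0.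
-/

noncomputable section

open scoped BigOperators Topology ENNReal NNReal MeasureTheory
open Set Function MeasureTheory
open Literature.Geometry.Riemannian.SphericalCylinderEntropy (zonal gegen wt wt_zero gegen_zero)
open Literature.Geometry.Riemannian.SphericalZonalKernelSeries (norm_wt_mul_gegen_le summable_majorant
  continuous_gegen)

set_option linter.dupNamespace false

namespace Summit.SmoothPoincare4.SmoothPoincare4.Theorems.ThinCrossSectionExists.BallMassSlack

namespace ZonalSphereIntegral

/-- Cauchy–Schwarz on the sphere: `|∑ xᵢuᵢ| ≤ 1` for `x ∈ S⁴` and a unit `u`. [folklore] -/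
theorem abs_sum_mul_le_one_of_mem_sphere {u : EuclideanSpace ℝ (Fin 5)} (hu : ∑ i : Fin 5, u i ^ 2 = 1)
    {x : EuclideanSpace ℝ (Fin 5)} (hx : x ∈ Metric.sphere (0 : EuclideanSpace ℝ (Fin 5)) 1) :
    |∑ i : Fin 5, x i * u i| ≤ 1 := by
  have h := Finset.sum_mul_sq_le_sq_mul_sq Finset.univ (fun i : Fin 5 => x i) (fun i : Fin 5 => u i)
  simp only [SliceDensity.sum_sq_eq_one_of_mem hx, hu, mul_one] at h
  rw [← sq_le_one_iff_abs_le_one]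
  exact h

end ZonalSphereIntegral

open ZonalSphereIntegral

/-- **STUB K2 (`stub_zonalSphereIntegral`) of line `ball-mass-slack`, proved.**  Given the Funk–Hecke vanishing of the
`k ≥ 1` Gegenbauer modes on the round `S⁴` (stub K1, as the hypothesis), the typed zonal heat series has total mass
`∫_{S⁴} 𝔥(τ, ∑ xᵢuᵢ) dμHE⁴ = μHE⁴(S⁴)` for every `τ > 0` and unit `u`: dominated exchange of `∫` and `∑'` (uniform term
bound `e^{-k²τ}((k+3)!)² 2^k` on the sphere, summable by the ratio test), the `k ≥ 1` integrals vanish, and the `k = 0`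
term is the constant `1`. [folklore] -/
theorem stub_zonalSphereIntegral :
    (∀ k : ℕ, 1 ≤ k → ∀ u : EuclideanSpace ℝ (Fin 5), ∑ i : Fin 5, u i ^ 2 = 1 →
      ∫ x in Metric.sphere (0 : EuclideanSpace ℝ (Fin 5)) 1, gegen k (∑ i : Fin 5, x i * u i) ∂μHE[4] = 0) →
    ∀ τ : ℝ, 0 < τ → ∀ u : EuclideanSpace ℝ (Fin 5), ∑ i : Fin 5, u i ^ 2 = 1 →
      ∫ x in Metric.sphere (0 : EuclideanSpace ℝ (Fin 5)) 1, zonal τ (∑ i : Fin 5, x i * u i) ∂μHE[4] =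
        (μHE[4] (Metric.sphere (0 : EuclideanSpace ℝ (Fin 5)) 1)).toReal := by
  intro hK1 τ hτ u hu
  set S : Set (EuclideanSpace ℝ (Fin 5)) := Metric.sphere (0 : EuclideanSpace ℝ (Fin 5)) 1 with hS_def
  set μ : Measure (EuclideanSpace ℝ (Fin 5)) := μHE[4] with hμ_def
  have hfin : μ S < ⊤ := SliceDensity.euclideanHausdorff_sphere_lt_top
  have hSm : MeasurableSet S := Metric.isClosed_sphere.measurableSet
  -- the terms of the series as functions on `ℝ⁵`
  set F : ℕ → EuclideanSpace ℝ (Fin 5) → ℝ := fun k x => wt k τ * gegen k (∑ i : Fin 5, x i * u i) with hF_def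
  have hFc : ∀ k, Continuous (F k) := fun k =>
    continuous_const.mul ((continuous_gegen k).comp (by fun_prop))
  -- the uniform bound on the sphere
  set B : ℕ → ℝ := fun k =>
    Real.exp (-(k : ℝ) ^ 2 * τ) * (((k + 3).factorial : ℕ) : ℝ) ^ 2 * (2 * (1 : ℝ)) ^ k with hB_def
  have hB : ∀ k, ∀ x ∈ S, ‖F k x‖ ≤ B k := fun k x hx =>
    norm_wt_mul_gegen_le hτ le_rfl (abs_sum_mul_le_one_of_mem_sphere hu hx) k
  -- integrability of each term on the sphere (bounded, finite measure)
  have hFint : ∀ k, Integrable (F k) (μ.restrict S) := fun k =>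
    Measure.integrableOn_of_bounded (M := B k) hfin.ne (hFc k).aestronglyMeasurable
      ((ae_restrict_iff' hSm).2 (ae_of_all _ fun x hx => hB k x hx))
  -- summability of the integrated norms
  have hsum : Summable fun k => ∫ x in S, ‖F k x‖ ∂μ := by
    refine Summable.of_nonneg_of_le (fun k => integral_nonneg fun _ => norm_nonneg _) (fun k => ?_)
      ((summable_majorant hτ (c := 2 * (1 : ℝ)) (by norm_num)).mul_right (μ.real S))
    have h := norm_setIntegral_le_of_norm_le_const hfin (f := fun x => ‖F k x‖) (C := B k)
      (fun x hx => by rw [norm_norm]; exact hB k x hx)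
    exact (Real.le_norm_self _).trans h
  -- exchange `∫` and `∑'`
  have hz : (fun x : EuclideanSpace ℝ (Fin 5) => zonal τ (∑ i : Fin 5, x i * u i)) =
      fun x => ∑' k, F k x := rfl
  rw [hz, ← integral_tsum_of_summable_integral_norm hFint hsum]
  -- each term: the constant `wt k τ` comes out; `k ≥ 1` vanishes by K1; `k = 0` is the constant `1`
  have hterm : ∀ k, ∫ x in S, F k x ∂μ = wt k τ * ∫ x in S, gegen k (∑ i : Fin 5, x i * u i) ∂μ :=
    fun k => integral_const_mul _ _
  simp_rw [hterm]
  rw [tsum_eq_single 0 fun k hk => by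
    rw [hμ_def, hS_def, hK1 k (Nat.one_le_iff_ne_zero.2 hk) u hu, mul_zero]]
  simp [wt_zero, gegen_zero, measureReal_def]

end Summit.SmoothPoincare4.SmoothPoincare4.Theorems.ThinCrossSectionExists.BallMassSlack

end
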